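import Mathlib.Combinatorics.SimpleGraph.Connectivity.Connected
import Mathlib.Combinatorics.SimpleGraph.Operations
import Literature.Computability.QuantumComplexity.PathModelLinkStates
import HarnessLib

/-!
# The loop number of a smoothed plat diagram by the cap-state recursion

Topic `Literature/Computability/QuantumComplexity`; third layer of the decomposition of
`ajl_jonesApproxProblem_mem_PromiseBQP` (`JonesInBQP.lean`): the graph-theoretic half of the
tree proof of `ajl_thm32_matrixElement` (`PathModelRepresentation.lean`). The tree's Kauffman
bracket (`kauffmanBracketPlat`, `JonesPolynomial.lean`) counts the loops `|σ|` of a smoothing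
state as the connected components of the smoothed plat diagram (`loopCount`, a
`SimpleGraph.ConnectedComponent` count); the algebraic half (`PathModelLinkStates.lean`,
`ajl_thm32_of_loopCount`) needs this count in the recursive form `cExt` of the cap-state
calculus (read the diagram slice by slice from the bottom cups: a capcup slice closes a loop
when it caps two partners and otherwise splices the matching; then cap off the top). This file
proves `loopCount = cExt` by building the smoothed diagram edge by edge and tracking
reachability:

* generic lemmas on adding one edge to a simple graph (`reachable_sup_edge_iff`, the component
  count `card_connectedComponent_sup_edge`) and the component count of the empty graph;
* the smoothed plat diagram as an explicit supremum of edges (`platGraph`, proved equal to the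
  tree's `smoothingGraph`);
* the slice induction (bottom caps, then for each crossing the cap, the cup and the vertical
  segments) and the closing induction (the top caps, in the order of `closingList`).

## References

* D. Aharonov, V. Jones, Z. Landau, arXiv:quant-ph/0511096, Def. 2.5 (products of Kauffman
  diagrams, "`m` extra closed loops"), Def. 2.9 (`|σ|`) [AharonovJonesLandau2009].
* L. H. Kauffman, *State models and the Jones polynomial*, Topology 26 (1987).
-/

noncomputable section

open SimpleGraph Finset

namespace Literature.Computability.QuantumComplexity

/-! ### Adding one edge to a simple graph -/

section SupEdge

variable {V : Type*} (G : SimpleGraph V) (u v : V)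

/-- **Reachability after adding the edge `uv`**: a walk either avoids the new edge or crosses it,
so `x ~ y` in `G ⊔ uv` iff `x ~ y`, or `x ~ u` and `v ~ y`, or `x ~ v` and `u ~ y` in `G`. [folklore] -/
theorem reachable_sup_edge_iff (x y : V) :
    (G ⊔ edge u v).Reachable x y ↔ G.Reachable x y ∨ (G.Reachable x u ∧ G.Reachable v y) ∨
      (G.Reachable x v ∧ G.Reachable u y) := by
  constructor
  · rintro ⟨p⟩
    induction p with
    | nil => exact Or.inl (Reachable.refl _)
    | @cons a b c hab _ ih =>
      rw [sup_adj, edge_adj] at hab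
      rcases hab with hab | ⟨⟨rfl, rfl⟩ | ⟨rfl, rfl⟩, -⟩
      · rcases ih with h | ⟨h1, h2⟩ | ⟨h1, h2⟩
        · exact Or.inl (hab.reachable.trans h)
        · exact Or.inr (Or.inl ⟨hab.reachable.trans h1, h2⟩)
        · exact Or.inr (Or.inr ⟨hab.reachable.trans h1, h2⟩)
      · -- the step is `u → v`
        rcases ih with h | ⟨-, h2⟩ | ⟨-, h2⟩
        · exact Or.inr (Or.inl ⟨Reachable.refl _, h⟩)
        · exact Or.inr (Or.inl ⟨Reachable.refl _, h2⟩)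
        · exact Or.inl h2
      · -- the step is `v → u`
        rcases ih with h | ⟨-, h2⟩ | ⟨-, h2⟩
        · exact Or.inr (Or.inr ⟨Reachable.refl _, h⟩)
        · exact Or.inl h2
        · exact Or.inr (Or.inr ⟨Reachable.refl _, h2⟩)
  · have hle : G ≤ G ⊔ edge u v := le_sup_left
    rintro (h | ⟨h1, h2⟩ | ⟨h1, h2⟩)
    · exact h.mono hle
    · by_cases huv : u = v
      · subst huv; exact (h1.mono hle).trans (h2.mono hle)
      · have : (G ⊔ edge u v).Adj u v := by rw [sup_adj, edge_adj]; exact Or.inr ⟨Or.inl ⟨rfl, rfl⟩, huv⟩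
        exact ((h1.mono hle).trans this.reachable).trans (h2.mono hle)
    · by_cases huv : u = v
      · subst huv; exact (h1.mono hle).trans (h2.mono hle)
      · have : (G ⊔ edge u v).Adj v u := by
          rw [sup_adj, edge_adj]; exact Or.inr ⟨Or.inr ⟨rfl, rfl⟩, Ne.symm huv⟩
        exact ((h1.mono hle).trans this.reachable).trans (h2.mono hle)

/-- **The component count after adding the edge `uv`** (finite vertex set): it drops by one if
`u`, `v` were in different components and is unchanged otherwise. [folklore] -/
theorem card_connectedComponent_sup_edge [Finite V] [Decidable (G.Reachable u v)] :
    Nat.card (G ⊔ edge u v).ConnectedComponent + (if G.Reachable u v then 0 else 1) =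
      Nat.card G.ConnectedComponent := by
  classical
  have hle : G ≤ G ⊔ edge u v := le_sup_left
  set φ := ConnectedComponent.map (Hom.ofLE hle) with hφ
  have hsurj : Function.Surjective φ := ConnectedComponent.surjective_map_ofLE hle
  have hφmk : ∀ a, φ (G.connectedComponentMk a) = (G ⊔ edge u v).connectedComponentMk a := fun a =>
    ConnectedComponent.map_mk _ _
  -- fibres of `φ`
  have hfib : ∀ a b : V, φ (G.connectedComponentMk a) = φ (G.connectedComponentMk b) ↔
      G.Reachable a b ∨ (G.Reachable a u ∧ G.Reachable v b) ∨ (G.Reachable a v ∧ G.Reachable u b) := by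
    intro a b
    rw [hφmk, hφmk, ConnectedComponent.eq, reachable_sup_edge_iff]
  haveI := Fintype.ofFinite G.ConnectedComponent
  haveI := Fintype.ofFinite (G ⊔ edge u v).ConnectedComponent
  rw [Nat.card_eq_fintype_card, Nat.card_eq_fintype_card]
  by_cases huv : G.Reachable u v
  · -- `φ` is a bijection
    rw [if_pos huv, add_zero]
    have hinj : Function.Injective φ := by
      intro C D hCD
      induction C using ConnectedComponent.ind with | h a => ?_
      induction D using ConnectedComponent.ind with | h b => ?_
      rw [ConnectedComponent.eq]
      rcases (hfib a b).1 hCD with h | ⟨h1, h2⟩ | ⟨h1, h2⟩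
      · exact h
      · exact h1.trans (huv.trans h2)
      · exact h1.trans (huv.symm.trans h2)
    exact (Fintype.card_of_bijective ⟨hinj, hsurj⟩).symm
  · -- `φ` identifies exactly the classes of `u` and `v`
    rw [if_neg huv]
    have hne : G.connectedComponentMk u ≠ G.connectedComponentMk v := by
      rwa [Ne, ConnectedComponent.eq]
    have himage : (Finset.univ.erase (G.connectedComponentMk v)).image φ = Finset.univ := by
      apply Finset.eq_univ_of_forall
      intro C'
      obtain ⟨C, rfl⟩ := hsurj C'
      rw [Finset.mem_image]
      by_cases hC : C = G.connectedComponentMk v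
      · refine ⟨G.connectedComponentMk u, by simp [hne], ?_⟩
        rw [hC, hfib]
        exact Or.inr (Or.inl ⟨Reachable.refl _, Reachable.refl _⟩)
      · exact ⟨C, by simp [hC], rfl⟩
    have hinj : Set.InjOn φ (Finset.univ.erase (G.connectedComponentMk v) : Finset _) := by
      intro C hC D hD hCD
      simp only [Finset.coe_erase, Finset.coe_univ, Set.mem_sdiff, Set.mem_univ, Set.mem_singleton_iff,
        true_and] at hC hD
      induction C using ConnectedComponent.ind with | h a => ?_
      induction D using ConnectedComponent.ind with | h b => ?_
      have hC' : ¬ G.Reachable a v := fun h => hC (ConnectedComponent.eq.2 h)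
      have hD' : ¬ G.Reachable b v := fun h => hD (ConnectedComponent.eq.2 h)
      rw [ConnectedComponent.eq]
      rcases (hfib a b).1 hCD with h | ⟨h1, h2⟩ | ⟨h1, h2⟩
      · exact h
      · exact absurd h2.symm hD'
      · exact absurd h1 hC'
    rw [← Finset.card_univ, ← himage, Finset.card_image_of_injOn hinj,
      Finset.card_erase_of_mem (Finset.mem_univ _), Finset.card_univ]
    have : 1 ≤ Fintype.card G.ConnectedComponent :=
      Fintype.card_pos_iff.2 ⟨G.connectedComponentMk v⟩
    omega

/-- The empty graph has one component per vertex. [folklore] -/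
theorem card_connectedComponent_bot [Finite V] :
    Nat.card (⊥ : SimpleGraph V).ConnectedComponent = Nat.card V := by
  symm
  apply Nat.card_eq_of_bijective (⊥ : SimpleGraph V).connectedComponentMk
  refine ⟨fun a b h => ?_, fun C => C.exists_rep⟩
  rwa [ConnectedComponent.eq, reachable_bot] at h

end SupEdge

/-! ### The smoothed plat diagram as a supremum of edges -/

section PlatGraph

variable {n m : ℕ} (w : Fin m → Fin (n - 1) × Bool) (s : Fin m → Bool)

/-- The first `t` plat caps at level `L`: the edges `(L, 2l) — (L, 2l+1)`, `l < t`.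
[cite: AharonovJonesLandau2009, Def. 2.8 (plat closure)] -/
def capsGraph (L : Fin (m + 1)) : (t : ℕ) → 2 * t ≤ n → SimpleGraph (DiagramPoint m n)
  | 0, _ => ⊥
  | t + 1, ht => capsGraph L t (by omega) ⊔ edge (L, ⟨2 * t, by omega⟩) (L, ⟨2 * t + 1, by omega⟩)

/-- Whether the vertical segment at position `p` across crossing `j` is present (absent at the
two positions of a capcup-smoothed crossing). [cite: AharonovJonesLandau2009, Def. 2.9] -/
def vertPresent (j : Fin m) (p : Fin n) : Prop :=
  ¬ (s j = true ∧ ((p : ℕ) = ((w j).1 : ℕ) ∨ (p : ℕ) = ((w j).1 : ℕ) + 1))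

/-- Decidability of `vertPresent`. [folklore] -/
instance (j : Fin m) (p : Fin n) : Decidable (vertPresent w s j p) := by
  unfold vertPresent; infer_instance

/-- The vertical segments across crossing `j` at the positions `p < t`. [cite: AharonovJonesLandau2009, Def. 2.9] -/
def vertsGraph (j : Fin m) : (t : ℕ) → t ≤ n → SimpleGraph (DiagramPoint m n)
  | 0, _ => ⊥
  | t + 1, ht => vertsGraph j t (by omega) ⊔
      (if vertPresent w s j ⟨t, by omega⟩ then edge (j.castSucc, ⟨t, by omega⟩) (j.succ, ⟨t, by omega⟩) else ⊥)

/-- The cap (below) of a capcup-smoothed crossing `j`. [cite: AharonovJonesLandau2009, Def. 2.9] -/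
def capEdge (j : Fin m) : SimpleGraph (DiagramPoint m n) :=
  if s j = true then edge (j.castSucc, genFst (w j).1) (j.castSucc, genSnd (w j).1) else ⊥

/-- The cup (above) of a capcup-smoothed crossing `j`. [cite: AharonovJonesLandau2009, Def. 2.9] -/
def cupEdge (j : Fin m) : SimpleGraph (DiagramPoint m n) :=
  if s j = true then edge (j.succ, genFst (w j).1) (j.succ, genSnd (w j).1) else ⊥

/-- The open diagram `Ω_j`: bottom caps and the first `j` slices (no top caps).
[cite: AharonovJonesLandau2009, Def. 2.5] -/
def openGraph : (j : ℕ) → j ≤ m → SimpleGraph (DiagramPoint m n)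
  | 0, _ => capsGraph 0 (n / 2) (Nat.mul_div_le n 2)
  | j + 1, hj => ((openGraph j (by omega) ⊔ capEdge w s ⟨j, by omega⟩) ⊔ cupEdge w s ⟨j, by omega⟩) ⊔
      vertsGraph w s ⟨j, by omega⟩ n le_rfl

/-- The top cap `(m, 2l) — (m, 2l+1)`. [cite: AharonovJonesLandau2009, Def. 2.8] -/
def topCap (l : ℕ) (hl : 2 * l + 2 ≤ n) : SimpleGraph (DiagramPoint m n) :=
  edge (Fin.last m, ⟨2 * l, by omega⟩) (Fin.last m, ⟨2 * l + 1, by omega⟩)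

/-- The top caps `(m, 2l) — (m, 2l+1)` for `t ≤ l < n/2`. [cite: AharonovJonesLandau2009, Def. 2.8] -/
def topCapsFrom (t : ℕ) : SimpleGraph (DiagramPoint m n) :=
  ⨆ l : {l : ℕ // t ≤ l ∧ 2 * l + 2 ≤ n}, topCap (m := m) l.1 l.2.2

/-- The whole smoothed plat diagram, assembled. [cite: AharonovJonesLandau2009, Def. 2.9] -/
def platGraph : SimpleGraph (DiagramPoint m n) :=
  openGraph w s m le_rfl ⊔ topCapsFrom 0

/-! #### Adjacency of the pieces -/

variable {w s}

/-- Adjacency in `capsGraph`. [folklore] -/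
theorem capsGraph_adj (L : Fin (m + 1)) (t : ℕ) (ht : 2 * t ≤ n) (a b : DiagramPoint m n) :
    (capsGraph L t ht).Adj a b ↔ a ≠ b ∧ a.1 = L ∧ b.1 = L ∧
      ∃ l : ℕ, l < t ∧ (((a.2 : ℕ) = 2 * l ∧ (b.2 : ℕ) = 2 * l + 1) ∨
        ((b.2 : ℕ) = 2 * l ∧ (a.2 : ℕ) = 2 * l + 1)) := by
  induction t with
  | zero => simp [capsGraph]
  | succ t ih =>
    rw [capsGraph, sup_adj, ih (by omega), edge_adj]
    constructor
    · rintro (⟨hne, ha, hb, l, hl, h⟩ | ⟨h, hne⟩)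
      · exact ⟨hne, ha, hb, l, by omega, h⟩
      · rcases h with ⟨rfl, rfl⟩ | ⟨rfl, rfl⟩
        · exact ⟨hne, rfl, rfl, t, by omega, Or.inl ⟨rfl, rfl⟩⟩
        · exact ⟨hne, rfl, rfl, t, by omega, Or.inr ⟨rfl, rfl⟩⟩
    · rintro ⟨hne, ha, hb, l, hl, h⟩
      rcases Nat.lt_or_ge l t with hlt | hlt
      · exact Or.inl ⟨hne, ha, hb, l, hlt, h⟩
      · obtain rfl : l = t := by omega
        right
        refine ⟨?_, hne⟩
        obtain ⟨a1, a2⟩ := a; obtain ⟨b1, b2⟩ := b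
        simp only at ha hb h ⊢
        subst ha; subst hb
        rcases h with ⟨h1, h2⟩ | ⟨h1, h2⟩
        · left; constructor <;> ext <;> simp [h1, h2]
        · right; constructor <;> ext <;> simp [h1, h2]

/-- Adjacency in `vertsGraph`. [folklore] -/
theorem vertsGraph_adj (j : Fin m) (t : ℕ) (ht : t ≤ n) (a b : DiagramPoint m n) :
    (vertsGraph w s j t ht).Adj a b ↔ a ≠ b ∧ ∃ p : Fin n, (p : ℕ) < t ∧ vertPresent w s j p ∧
      ((a = (j.castSucc, p) ∧ b = (j.succ, p)) ∨ (a = (j.succ, p) ∧ b = (j.castSucc, p))) := by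
  induction t with
  | zero => simp [vertsGraph]
  | succ t ih =>
    rw [vertsGraph, sup_adj, ih (by omega)]
    constructor
    · rintro (⟨hne, p, hp, hv, h⟩ | h)
      · exact ⟨hne, p, by omega, hv, h⟩
      · split_ifs at h with hv
        · rw [edge_adj] at h
          exact ⟨h.2, _, by simp, hv, h.1⟩
        · simp at h
    · rintro ⟨hne, p, hp, hv, h⟩
      rcases Nat.lt_or_ge p t with hlt | hlt
      · exact Or.inl ⟨hne, p, hlt, hv, h⟩
      · have hp' : p = ⟨t, by omega⟩ := Fin.ext (by simp; omega)
        rw [hp'] at hv h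
        right
        rw [if_pos hv, edge_adj]
        exact ⟨h, hne⟩

/-- No top caps from an index past `n/2`. [folklore] -/
theorem topCapsFrom_of_gt (t : ℕ) (ht : n < 2 * t + 2) : topCapsFrom (m := m) (n := n) t = ⊥ := by
  ext a b
  simp only [topCapsFrom, iSup_adj, bot_adj, iff_false, not_exists]
  rintro ⟨l, hl1, hl2⟩
  omega

/-- Peeling the lowest top cap. [folklore] -/
theorem topCapsFrom_eq_sup (t : ℕ) (ht : 2 * t + 2 ≤ n) :
    topCapsFrom (m := m) (n := n) t = topCapsFrom (t + 1) ⊔ topCap t ht := by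
  ext a b
  simp only [topCapsFrom, iSup_adj, sup_adj]
  constructor
  · rintro ⟨⟨l, hl1, hl2⟩, h⟩
    rcases Nat.eq_or_lt_of_le hl1 with rfl | hlt
    · exact Or.inr h
    · exact Or.inl ⟨⟨l, hlt, hl2⟩, h⟩
  · rintro (⟨⟨l, hl1, hl2⟩, h⟩ | h)
    · exact ⟨⟨l, by omega, hl2⟩, h⟩
    · exact ⟨⟨t, le_rfl, ht⟩, h⟩

/-- Adjacency in `topCapsFrom 0` (all top caps). [folklore] -/
theorem topCapsFrom_zero_adj (a b : DiagramPoint m n) :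
    (topCapsFrom (m := m) (n := n) 0).Adj a b ↔ a ≠ b ∧ a.1 = Fin.last m ∧ b.1 = Fin.last m ∧
      ∃ l : ℕ, 2 * l + 2 ≤ n ∧ (((a.2 : ℕ) = 2 * l ∧ (b.2 : ℕ) = 2 * l + 1) ∨
        ((b.2 : ℕ) = 2 * l ∧ (a.2 : ℕ) = 2 * l + 1)) := by
  rw [topCapsFrom, iSup_adj]
  constructor
  · rintro ⟨⟨l, h0, hl⟩, h⟩
    simp only [topCap, edge_adj] at h
    obtain ⟨h, hne⟩ := h
    refine ⟨hne, ?_⟩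
    rcases h with ⟨rfl, rfl⟩ | ⟨rfl, rfl⟩
    · exact ⟨rfl, rfl, l, hl, Or.inl ⟨rfl, rfl⟩⟩
    · exact ⟨rfl, rfl, l, hl, Or.inr ⟨rfl, rfl⟩⟩
  · rintro ⟨hne, ha, hb, l, hl, h⟩
    refine ⟨⟨l, Nat.zero_le _, hl⟩, ?_⟩
    simp only [topCap, edge_adj]
    refine ⟨?_, hne⟩
    obtain ⟨a1, a2⟩ := a; obtain ⟨b1, b2⟩ := b
    simp only at ha hb h ⊢
    subst ha; subst hb
    rcases h with ⟨h1, h2⟩ | ⟨h1, h2⟩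
    · left; constructor <;> ext <;> simp [h1, h2]
    · right; constructor <;> ext <;> simp [h1, h2]

/-- Adjacency in `capEdge`. [folklore] -/
theorem capEdge_adj (j : Fin m) (a b : DiagramPoint m n) :
    (capEdge w s j).Adj a b ↔ s j = true ∧ a ≠ b ∧
      ((a = (j.castSucc, genFst (w j).1) ∧ b = (j.castSucc, genSnd (w j).1)) ∨
        (a = (j.castSucc, genSnd (w j).1) ∧ b = (j.castSucc, genFst (w j).1))) := by
  unfold capEdge
  split_ifs with h
  · rw [edge_adj]; constructor
    · rintro ⟨h1, h2⟩; exact ⟨h, h2, h1⟩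
    · rintro ⟨-, h2, h1⟩; exact ⟨h1, h2⟩
  · simp [h]

/-- Adjacency in `cupEdge`. [folklore] -/
theorem cupEdge_adj (j : Fin m) (a b : DiagramPoint m n) :
    (cupEdge w s j).Adj a b ↔ s j = true ∧ a ≠ b ∧
      ((a = (j.succ, genFst (w j).1) ∧ b = (j.succ, genSnd (w j).1)) ∨
        (a = (j.succ, genSnd (w j).1) ∧ b = (j.succ, genFst (w j).1))) := by
  unfold cupEdge
  split_ifs with h
  · rw [edge_adj]; constructor
    · rintro ⟨h1, h2⟩; exact ⟨h, h2, h1⟩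
    · rintro ⟨-, h2, h1⟩; exact ⟨h1, h2⟩
  · simp [h]

/-- Adjacency in the open diagram `Ω_j`. [folklore] -/
theorem openGraph_adj (j : ℕ) (hj : j ≤ m) (a b : DiagramPoint m n) :
    (openGraph w s j hj).Adj a b ↔ (capsGraph 0 (n / 2) (Nat.mul_div_le n 2)).Adj a b ∨
      ∃ j' : Fin m, (j' : ℕ) < j ∧ ((capEdge w s j').Adj a b ∨ (cupEdge w s j').Adj a b ∨
        (vertsGraph w s j' n le_rfl).Adj a b) := by
  induction j with
  | zero => simp [openGraph]
  | succ j ih =>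
    rw [openGraph, sup_adj, sup_adj, sup_adj, ih (by omega)]
    constructor
    · intro hab
      rcases hab with hab | hab
      · rcases hab with hab | hab
        · rcases hab with hab | hab
          · rcases hab with hab | ⟨j', hj', hab⟩
            · exact Or.inl hab
            · exact Or.inr ⟨j', by omega, hab⟩
          · exact Or.inr ⟨⟨j, by omega⟩, by simp, Or.inl hab⟩
        · exact Or.inr ⟨⟨j, by omega⟩, by simp, Or.inr (Or.inl hab)⟩
      · exact Or.inr ⟨⟨j, by omega⟩, by simp, Or.inr (Or.inr hab)⟩
    · rintro (h | ⟨j', hj', h⟩)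
      · exact Or.inl (Or.inl (Or.inl (Or.inl h)))
      · rcases Nat.lt_or_ge j' j with hlt | hlt
        · exact Or.inl (Or.inl (Or.inl (Or.inr ⟨j', hlt, h⟩)))
        · have : j' = ⟨j, by omega⟩ := Fin.ext (by simp; omega)
          rw [this] at h
          rcases h with h | h | h
          · exact Or.inl (Or.inl (Or.inr h))
          · exact Or.inl (Or.inr h)
          · exact Or.inr h

/-- A present vertical segment is an arc of the smoothed diagram. [cite: AharonovJonesLandau2009, Def. 2.9] -/
theorem smoothingRel_vert (j : Fin m) (p : Fin n) (hv : vertPresent w s j p) :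
    smoothingRel w s (j.castSucc, p) (j.succ, p) :=
  Or.inl ⟨j, rfl, rfl, rfl, hv⟩

/-- The cap and the cup of a capcup-smoothed crossing are arcs of the smoothed diagram.
[cite: AharonovJonesLandau2009, Def. 2.9] -/
theorem smoothingRel_capcup (j : Fin m) (hs : s j = true) (L : Fin (m + 1))
    (hL : L = j.castSucc ∨ L = j.succ) :
    smoothingRel w s (L, genFst (w j).1) (L, genSnd (w j).1) := by
  refine Or.inr (Or.inl ⟨j, hs, rfl, rfl, ?_⟩)
  rcases hL with rfl | rfl
  · exact Or.inl ⟨rfl, rfl⟩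
  · exact Or.inr ⟨rfl, rfl⟩

/-- The plat caps are arcs of the smoothed diagram. [cite: AharonovJonesLandau2009, Def. 2.8] -/
theorem smoothingRel_platCap (L : Fin (m + 1)) (hL : L = 0 ∨ L = Fin.last m) (l : ℕ) (hl : 2 * l + 2 ≤ n) :
    smoothingRel w s (L, ⟨2 * l, by omega⟩) (L, ⟨2 * l + 1, by omega⟩) := by
  refine Or.inr (Or.inr ⟨?_, ⟨l, by simp; ring⟩, rfl⟩)
  rcases hL with rfl | rfl
  · exact Or.inl ⟨rfl, rfl⟩
  · exact Or.inr ⟨rfl, rfl⟩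

/-- From an `edge x y` adjacency to the smoothed diagram. [folklore] -/
theorem smoothingGraph_adj_of_edge_adj {x y a b : DiagramPoint m n} (hr : smoothingRel w s x y)
    (h : (edge x y).Adj a b) : (smoothingGraph w s).Adj a b := by
  rw [smoothingGraph, SimpleGraph.fromRel_adj]
  rw [edge_adj] at h
  obtain ⟨h, hne⟩ := h
  refine ⟨hne, ?_⟩
  rcases h with ⟨rfl, rfl⟩ | ⟨rfl, rfl⟩
  · exact Or.inl hr
  · exact Or.inr hr

/-- `platGraph ≤ smoothingGraph`. [cite: AharonovJonesLandau2009, Def. 2.9] -/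
theorem platGraph_le_smoothingGraph : platGraph w s ≤ smoothingGraph w s := by
  intro a b hab
  rw [platGraph, sup_adj, openGraph_adj] at hab
  rcases hab with (hab | ⟨j, -, hab | hab | hab⟩) | hab
  · -- bottom caps
    rw [capsGraph_adj] at hab
    obtain ⟨hne, ha, hb, l, hl, h⟩ := hab
    have hr := smoothingRel_platCap (w := w) (s := s) 0 (Or.inl rfl) l (by omega)
    apply smoothingGraph_adj_of_edge_adj hr
    rw [edge_adj]
    refine ⟨?_, hne⟩
    obtain ⟨a1, a2⟩ := a; obtain ⟨b1, b2⟩ := b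
    simp only at ha hb h; subst ha; subst hb
    rcases h with ⟨h1, h2⟩ | ⟨h1, h2⟩
    · left; constructor <;> ext <;> simp [h1, h2]
    · right; constructor <;> ext <;> simp [h1, h2]
  · -- cap
    unfold capEdge at hab
    split_ifs at hab with hs
    · exact smoothingGraph_adj_of_edge_adj (smoothingRel_capcup j hs _ (Or.inl rfl)) hab
    · exact absurd hab (by simp)
  · -- cup
    unfold cupEdge at hab
    split_ifs at hab with hs
    · exact smoothingGraph_adj_of_edge_adj (smoothingRel_capcup j hs _ (Or.inr rfl)) hab
    · exact absurd hab (by simp)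
  · -- vertical
    rw [vertsGraph_adj] at hab
    obtain ⟨hne, p, -, hv, h⟩ := hab
    apply smoothingGraph_adj_of_edge_adj (smoothingRel_vert j p hv)
    rw [edge_adj]
    exact ⟨h, hne⟩
  · -- top caps
    rw [topCapsFrom_zero_adj] at hab
    obtain ⟨hne, ha, hb, l, hl, h⟩ := hab
    have hr := smoothingRel_platCap (w := w) (s := s) (Fin.last m) (Or.inr rfl) l hl
    apply smoothingGraph_adj_of_edge_adj hr
    rw [edge_adj]
    refine ⟨?_, hne⟩
    obtain ⟨a1, a2⟩ := a; obtain ⟨b1, b2⟩ := b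
    simp only at ha hb h; subst ha; subst hb
    rcases h with ⟨h1, h2⟩ | ⟨h1, h2⟩
    · left; constructor <;> ext <;> simp [h1, h2]
    · right; constructor <;> ext <;> simp [h1, h2]

/-- `smoothingGraph ≤ platGraph`: every arc of the tree's relation is one of the assembled edges.
[cite: AharonovJonesLandau2009, Def. 2.9] -/
theorem smoothingGraph_le_platGraph : smoothingGraph w s ≤ platGraph w s := by
  -- oriented arcs first
  have key : ∀ a b : DiagramPoint m n, a ≠ b → smoothingRel w s a b → (platGraph w s).Adj a b := by
    rintro ⟨a1, a2⟩ ⟨b1, b2⟩ hne (⟨j, h1, h2, h3, h4⟩ | ⟨j, hs, h2, h3, h4⟩ | ⟨h1, he, h3⟩)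
    · -- vertical
      simp only at h1 h2 h3 h4
      subst h1; subst h2; subst h3
      rw [platGraph, sup_adj, openGraph_adj]
      refine Or.inl (Or.inr ⟨j, j.2, Or.inr (Or.inr ?_)⟩)
      rw [vertsGraph_adj]
      exact ⟨hne, a2, a2.2, h4, Or.inl ⟨rfl, rfl⟩⟩
    · -- capcup
      simp only at h2 h3 h4
      have ha : a2 = genFst (w j).1 := Fin.ext h2
      have hb : b2 = genSnd (w j).1 := Fin.ext h3
      subst ha; subst hb
      rw [platGraph, sup_adj, openGraph_adj]
      rcases h4 with ⟨rfl, rfl⟩ | ⟨rfl, rfl⟩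
      · refine Or.inl (Or.inr ⟨j, j.2, Or.inl ?_⟩)
        rw [capEdge, if_pos hs, edge_adj]
        exact ⟨Or.inl ⟨rfl, rfl⟩, hne⟩
      · refine Or.inl (Or.inr ⟨j, j.2, Or.inr (Or.inl ?_)⟩)
        rw [cupEdge, if_pos hs, edge_adj]
        exact ⟨Or.inl ⟨rfl, rfl⟩, hne⟩
    · -- plat caps
      simp only at h1 he h3
      obtain ⟨l, hl⟩ := he
      have hl' : (a2 : ℕ) = 2 * l := by omega
      have hln : 2 * l + 2 ≤ n := by have := b2.2; omega
      have h2l : 2 * l < n := by omega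
      have h2l1 : 2 * l + 1 < n := by omega
      have ha : a2 = ⟨2 * l, h2l⟩ := Fin.ext (by simp [hl'])
      have hb : b2 = ⟨2 * l + 1, h2l1⟩ := Fin.ext (by simp; omega)
      subst ha; subst hb
      rw [platGraph, sup_adj, openGraph_adj]
      rcases h1 with ⟨rfl, rfl⟩ | ⟨rfl, rfl⟩
      · refine Or.inl (Or.inl ?_)
        rw [capsGraph_adj]
        exact ⟨hne, rfl, rfl, l, by omega, Or.inl ⟨rfl, rfl⟩⟩
      · refine Or.inr ?_
        rw [topCapsFrom_zero_adj]
        exact ⟨hne, rfl, rfl, l, hln, Or.inl ⟨rfl, rfl⟩⟩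
  intro a b hab
  rw [smoothingGraph, SimpleGraph.fromRel_adj] at hab
  obtain ⟨hne, h | h⟩ := hab
  · exact key a b hne h
  · exact (key b a hne.symm h).symm

/-- **The assembled graph is the tree's smoothed plat diagram.** [cite: AharonovJonesLandau2009, Def. 2.9] -/
theorem platGraph_eq_smoothingGraph : platGraph w s = smoothingGraph w s :=
  le_antisymm platGraph_le_smoothingGraph smoothingGraph_le_platGraph

/-- Hence the tree's loop number is the component count of `platGraph`. [cite: AharonovJonesLandau2009, Def. 2.9] -/
theorem loopCount_eq_card_platGraph :
    loopCount w s = Nat.card (platGraph w s).ConnectedComponent := by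
  rw [loopCount, platGraph_eq_smoothingGraph]

/-! ### Counting, I: the bottom caps -/

/-- The number of diagram points. [folklore] -/
theorem card_diagramPoint : Nat.card (DiagramPoint m n) = (m + 1) * n := by
  simp [DiagramPoint]

/-- **The bottom caps**: `t` caps make `t` two-point components; all other points are isolated.
[cite: AharonovJonesLandau2009, Def. 2.8] -/
theorem capsGraph_inv (t : ℕ) (ht : 2 * t ≤ n) :
    Nat.card (capsGraph (m := m) 0 t ht).ConnectedComponent + t = (m + 1) * n ∧
    ∀ x y : DiagramPoint m n, (capsGraph (m := m) 0 t ht).Reachable x y ↔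
      x = y ∨ (x.1 = 0 ∧ y.1 = 0 ∧ (x.2 : ℕ) / 2 = (y.2 : ℕ) / 2 ∧ (x.2 : ℕ) / 2 < t) := by
  induction t with
  | zero =>
    refine ⟨by rw [capsGraph, card_connectedComponent_bot, card_diagramPoint, add_zero], fun x y => ?_⟩
    rw [capsGraph, reachable_bot]
    simp
  | succ t ih =>
    obtain ⟨hc, hr⟩ := ih (by omega)
    have h2t : 2 * t < n := by omega
    have h2t1 : 2 * t + 1 < n := by omega
    set u : DiagramPoint m n := ((0 : Fin (m + 1)), (⟨2 * t, h2t⟩ : Fin n)) with hu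
    set v : DiagramPoint m n := ((0 : Fin (m + 1)), (⟨2 * t + 1, h2t1⟩ : Fin n)) with hv
    have huv : ¬ (capsGraph (m := m) 0 t (by omega)).Reachable u v := by
      rw [hr, hu, hv]
      simp only [Prod.ext_iff, Fin.ext_iff, true_and, not_or]
      omega
    classical
    refine ⟨?_, fun x y => ?_⟩
    · have key := card_connectedComponent_sup_edge (capsGraph (m := m) 0 t (by omega)) u v
      rw [if_neg huv] at key
      show Nat.card (capsGraph (m := m) 0 t (by omega) ⊔ edge u v).ConnectedComponent + (t + 1) = (m + 1) * n
      omega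
    · rw [capsGraph, ← hu, ← hv, reachable_sup_edge_iff, hr, hr, hr, hr, hr, hu, hv]
      obtain ⟨x1, x2⟩ := x
      obtain ⟨y1, y2⟩ := y
      simp only [Prod.ext_iff, Fin.ext_iff, Fin.val_zero]
      omega

/-! ### Counting, II: one slice -/

section Slice

variable (J : Fin m) (Ω : SimpleGraph (DiagramPoint m n)) (M : NCMatching n)

/-- The hypotheses carried along the slices: the reachability of the open diagram between the
points of its top level is the matching, and the points above the top level are isolated. [folklore] -/
structure SliceInv : Prop where
  /-- top-level reachability is the matching -/
  top : ∀ p p' : Fin n, Ω.Reachable (J.castSucc, p) (J.castSucc, p') ↔ p' = p ∨ p' = M.mate p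
  /-- points above the top level are isolated -/
  above : ∀ x y : DiagramPoint m n, J.castSucc < x.1 → Ω.Reachable x y → y = x

variable {J Ω M}

/-- **Stage A/B of a slice: the cap and the cup.** After adding the cap (if the crossing is
capcup-smoothed) the count drops by one unless `i`, `i+1` were partners; the cup is a fresh
two-point component. Reachability afterwards, in terms of that of `Ω`. [cite: AharonovJonesLandau2009, Def. 2.5] -/
theorem slice_capcup (hI : SliceInv J Ω M) [DecidableEq (DiagramPoint m n)] :
    let U : DiagramPoint m n := (J.castSucc, genFst (w J).1)
    let V : DiagramPoint m n := (J.castSucc, genSnd (w J).1)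
    let U' : DiagramPoint m n := (J.succ, genFst (w J).1)
    let V' : DiagramPoint m n := (J.succ, genSnd (w J).1)
    (Nat.card ((Ω ⊔ capEdge w s J) ⊔ cupEdge w s J).ConnectedComponent +
        (if s J = true then (if M.mate (genFst (w J).1) = genSnd (w J).1 then 1 else 2) else 0) =
      Nat.card Ω.ConnectedComponent) ∧
    ∀ x y : DiagramPoint m n, ((Ω ⊔ capEdge w s J) ⊔ cupEdge w s J).Reachable x y ↔
      (Ω.Reachable x y ∨ (s J = true ∧ ((Ω.Reachable x U ∧ Ω.Reachable V y) ∨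
        (Ω.Reachable x V ∧ Ω.Reachable U y)))) ∨ (s J = true ∧ ((x = U' ∧ y = V') ∨ (x = V' ∧ y = U'))) := by
  intro U V U' V'
  classical
  by_cases hs : s J = true
  · -- capcup-smoothed crossing
    have hcap : capEdge w s J = edge U V := by simp [capEdge, hs, U, V]
    have hcup : cupEdge w s J = edge U' V' := by simp [cupEdge, hs, U', V']
    -- stage A
    have hUV : Ω.Reachable U V ↔ M.mate (genFst (w J).1) = genSnd (w J).1 := by
      rw [hI.top]
      constructor
      · rintro (h | h)
        · exact absurd h (genFst_ne_genSnd _).symm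
        · exact h.symm
      · exact fun h => Or.inr h.symm
    have cA := card_connectedComponent_sup_edge Ω U V
    have rA := reachable_sup_edge_iff Ω U V
    -- stage B: `U'`, `V'` are isolated in `Ω ⊔ UV`
    have hlt : J.castSucc < J.succ := Fin.castSucc_lt_succ
    have isoA : ∀ z y, J.castSucc < z.1 → ((Ω ⊔ edge U V).Reachable z y ↔ y = z) := by
      intro z y hz
      rw [rA]
      have h1 : ∀ y, Ω.Reachable z y ↔ y = z := fun y =>
        ⟨hI.above z y hz, fun h => h ▸ Reachable.refl _⟩
      have hzU : U ≠ z := by rintro rfl; exact absurd hz (lt_irrefl _)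
      have hzV : V ≠ z := by rintro rfl; exact absurd hz (lt_irrefl _)
      simp [h1, hzU, hzV]
    have hU'V' : ¬ (Ω ⊔ edge U V).Reachable U' V' := by
      rw [isoA U' V' hlt]
      simp [U', V', Prod.ext_iff, (genFst_ne_genSnd (w J).1).symm]
    have cB := card_connectedComponent_sup_edge (Ω ⊔ edge U V) U' V'
    rw [if_neg hU'V'] at cB
    have rB := reachable_sup_edge_iff (Ω ⊔ edge U V) U' V'
    refine ⟨?_, fun x y => ?_⟩
    · rw [hcap, hcup, if_pos hs]
      split_ifs with hm
      · rw [if_pos (hUV.2 hm)] at cA; omega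
      · rw [if_neg (fun h => hm (hUV.1 h))] at cA; omega
    · -- `R x U'` in `Ω ⊔ UV` means `x = U'`
      have eU : ∀ x, (Ω ⊔ edge U V).Reachable x U' ↔ x = U' := fun x => by
        rw [reachable_comm, isoA U' x hlt]
      have eV : ∀ x, (Ω ⊔ edge U V).Reachable x V' ↔ x = V' := fun x => by
        rw [reachable_comm, isoA V' x hlt]
      rw [hcap, hcup, rB, eU, eV, isoA U' _ hlt, isoA V' _ hlt, rA]
      simp only [hs, true_and]
  · -- identity-smoothed crossing: nothing is added
    have hcap : capEdge w s J = ⊥ := by simp [capEdge, hs]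
    have hcup : cupEdge w s J = ⊥ := by simp [cupEdge, hs]
    rw [hcap, hcup, sup_bot_eq, sup_bot_eq, if_neg hs, add_zero]
    refine ⟨rfl, fun x y => ?_⟩
    simp [hs]

/-- The anchor of a point after the vertical segments at the positions `< t` have been added:
a point of level `J+1` hanging on a vertical segment is sent to the point below it. [folklore] -/
def anchor (w : Fin m → Fin (n - 1) × Bool) (s : Fin m → Bool) (J : Fin m) (t : ℕ)
    (x : DiagramPoint m n) : DiagramPoint m n :=
  if x.1 = J.succ ∧ (x.2 : ℕ) < t ∧ vertPresent w s J x.2 then (J.castSucc, x.2) else x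

/-- An anchor is the point itself or a point of level `J`. [folklore] -/
theorem anchor_eq_or (J : Fin m) (t : ℕ) (x : DiagramPoint m n) :
    anchor w s J t x = x ∨ (anchor w s J t x).1 = J.castSucc := by
  unfold anchor; split_ifs <;> simp

/-- Points off level `J+1` are their own anchors. [folklore] -/
theorem anchor_of_ne (J : Fin m) (t : ℕ) (x : DiagramPoint m n) (hx : x.1 ≠ J.succ) :
    anchor w s J t x = x := by
  unfold anchor; rw [if_neg]; exact fun h => hx h.1

/-- The anchor map with one more vertical segment. [folklore] -/
theorem anchor_succ (J : Fin m) (t : ℕ) (ht : t < n) (x : DiagramPoint m n) :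
    anchor w s J (t + 1) x =
      if x = (J.succ, ⟨t, ht⟩) ∧ vertPresent w s J ⟨t, ht⟩ then (J.castSucc, ⟨t, ht⟩) else anchor w s J t x := by
  obtain ⟨x1, x2⟩ := x
  unfold anchor
  simp only [Prod.mk.injEq]
  by_cases h1 : x1 = J.succ
  · subst h1
    by_cases h2 : x2 = ⟨t, ht⟩
    · subst h2
      simp
    · have h2' : (x2 : ℕ) ≠ t := fun e => h2 (Fin.ext e)
      have : ((x2 : ℕ) < t + 1) ↔ ((x2 : ℕ) < t) := by omega
      simp [h2, this]
  · simp [h1]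

/-- **Stage C of a slice: the vertical segments.** Each present vertical segment hangs the
(so far isolated) point above it onto the diagram: the count drops by one per segment and
reachability is read off through the anchors. [cite: AharonovJonesLandau2009, Def. 2.5] -/
theorem slice_verts (J : Fin m) (G : SimpleGraph (DiagramPoint m n))
    (hiso : ∀ p : Fin n, vertPresent w s J p → ∀ y, G.Reachable (J.succ, p) y → y = (J.succ, p))
    (t : ℕ) (ht : t ≤ n) :
    Nat.card (G ⊔ vertsGraph w s J t ht).ConnectedComponent +
        (Finset.univ.filter fun p : Fin n => (p : ℕ) < t ∧ vertPresent w s J p).card =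
      Nat.card G.ConnectedComponent ∧
    ∀ x y, (G ⊔ vertsGraph w s J t ht).Reachable x y ↔
      G.Reachable (anchor w s J t x) (anchor w s J t y) := by
  classical
  induction t with
  | zero =>
    have h0 : (Finset.univ.filter fun p : Fin n => (p : ℕ) < 0 ∧ vertPresent w s J p) = ∅ := by
      ext p; simp
    refine ⟨by rw [vertsGraph, sup_bot_eq, h0, Finset.card_empty, add_zero], fun x y => ?_⟩
    rw [vertsGraph, sup_bot_eq]
    unfold anchor
    simp
  | succ t ih =>
    obtain ⟨hc, hr⟩ := ih (by omega)
    have htn : t < n := by omega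
    set X : DiagramPoint m n := (J.succ, (⟨t, htn⟩ : Fin n)) with hX
    set Y : DiagramPoint m n := (J.castSucc, (⟨t, htn⟩ : Fin n)) with hY
    have hYX : Y ≠ X := by
      rw [hY, hX]; simp [Prod.ext_iff, Fin.castSucc_lt_succ.ne]
    by_cases hv : vertPresent w s J ⟨t, htn⟩
    · -- a new vertical segment `Y — X`
      have hG : G ⊔ vertsGraph w s J (t + 1) ht = (G ⊔ vertsGraph w s J t (by omega)) ⊔ edge Y X := by
        rw [vertsGraph, if_pos hv, sup_assoc]
      have hfilter : (Finset.univ.filter fun p : Fin n => (p : ℕ) < t + 1 ∧ vertPresent w s J p) =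
          insert ⟨t, htn⟩ (Finset.univ.filter fun p : Fin n => (p : ℕ) < t ∧ vertPresent w s J p) := by
        ext p
        simp only [Finset.mem_filter, Finset.mem_univ, true_and, Finset.mem_insert]
        constructor
        · rintro ⟨h1, h2⟩
          by_cases hp : (p : ℕ) = t
          · exact Or.inl (Fin.ext hp)
          · exact Or.inr ⟨by omega, h2⟩
        · rintro (rfl | ⟨h1, h2⟩)
          · exact ⟨by simp, hv⟩
          · exact ⟨by omega, h2⟩
      have hnotmem : (⟨t, htn⟩ : Fin n) ∉ (Finset.univ.filter fun p : Fin n => (p : ℕ) < t ∧ vertPresent w s J p) := by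
        simp
      -- `X` is isolated so far
      have haX : anchor w s J t X = X := by
        unfold anchor; rw [if_neg]; rw [hX]; simp
      have haY : anchor w s J t Y = Y := anchor_of_ne J t Y (by rw [hY]; exact (Fin.castSucc_lt_succ (i := J)).ne)
      have hane : ∀ z, z ≠ X → anchor w s J t z ≠ X := by
        intro z hz h
        rcases anchor_eq_or J t z with e | e
        · exact hz (e ▸ h)
        · rw [h, hX] at e
          exact absurd e (Fin.castSucc_lt_succ (i := J)).ne'
      have isoX : ∀ y, (G ⊔ vertsGraph w s J t (by omega)).Reachable X y ↔ y = X := by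
        intro y
        rw [hr, haX]
        constructor
        · intro h
          have := hiso ⟨t, htn⟩ hv _ h
          by_contra hy
          exact hane y hy this
        · rintro rfl; rw [haX]
      have hYXr : ¬ (G ⊔ vertsGraph w s J t (by omega)).Reachable Y X := by
        rw [reachable_comm, isoX]; exact hYX
      refine ⟨?_, fun x y => ?_⟩
      · have key := card_connectedComponent_sup_edge (G ⊔ vertsGraph w s J t (by omega)) Y X
        rw [if_neg hYXr] at key
        rw [hG, hfilter, Finset.card_insert_of_notMem hnotmem]
        omega
      · have eX : ∀ z, (G ⊔ vertsGraph w s J t (by omega)).Reachable z X ↔ z = X := fun z => by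
          rw [reachable_comm, isoX]
        have a' : ∀ z, anchor w s J (t + 1) z = if z = X then Y else anchor w s J t z := by
          intro z; rw [anchor_succ J t htn]; simp only [hv, and_true]; rfl
        rw [hG, reachable_sup_edge_iff, a', a']
        by_cases hx : x = X <;> by_cases hy : y = X
        · subst hx; subst hy
          simp only [if_true]
          exact ⟨fun _ => Reachable.refl _, fun _ => Or.inl (Reachable.refl _)⟩
        · subst hx
          rw [if_pos rfl, if_neg hy]
          constructor
          · rintro (h | ⟨-, h⟩ | ⟨-, h⟩)
            · exact absurd ((isoX y).1 h) hy
            · exact absurd ((isoX y).1 h) hy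
            · rwa [hr, haY] at h
          · intro h
            exact Or.inr (Or.inr ⟨Reachable.refl _, by rwa [hr, haY]⟩)
        · subst hy
          rw [if_neg hx, if_pos rfl]
          constructor
          · rintro (h | ⟨h, -⟩ | ⟨h, -⟩)
            · exact absurd ((eX x).1 h) hx
            · rwa [hr, haY] at h
            · exact absurd ((eX x).1 h) hx
          · intro h
            exact Or.inr (Or.inl ⟨by rwa [hr, haY], Reachable.refl _⟩)
        · rw [if_neg hx, if_neg hy]
          constructor
          · rintro (h | ⟨-, h⟩ | ⟨h, -⟩)
            · rwa [hr] at h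
            · exact absurd ((isoX y).1 h) hy
            · exact absurd ((eX x).1 h) hx
          · intro h
            exact Or.inl (by rwa [hr])
    · -- no segment at this position
      have hG : G ⊔ vertsGraph w s J (t + 1) ht = G ⊔ vertsGraph w s J t (by omega) := by
        rw [vertsGraph, if_neg hv, sup_bot_eq]
      have hfilter : (Finset.univ.filter fun p : Fin n => (p : ℕ) < t + 1 ∧ vertPresent w s J p) =
          (Finset.univ.filter fun p : Fin n => (p : ℕ) < t ∧ vertPresent w s J p) := by
        ext p
        simp only [Finset.mem_filter, Finset.mem_univ, true_and]
        constructor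
        · rintro ⟨h1, h2⟩
          by_cases hp : (p : ℕ) = t
          · exact absurd h2 (by have : p = ⟨t, htn⟩ := Fin.ext hp; rw [this]; exact hv)
          · exact ⟨by omega, h2⟩
        · rintro ⟨h1, h2⟩; exact ⟨by omega, h2⟩
      have hanc : ∀ z, anchor w s J (t + 1) z = anchor w s J t z := by
        intro z; rw [anchor_succ J t htn, if_neg]; exact fun h => hv h.2
      refine ⟨by rw [hG, hfilter]; exact hc, fun x y => ?_⟩
      rw [hG, hanc, hanc, hr]

/-- `vertPresent` in terms of the two capcup positions as elements of `Fin n`. [folklore] -/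
theorem vertPresent_iff (J : Fin m) (p : Fin n) :
    vertPresent w s J p ↔ ¬ (s J = true ∧ (p = genFst (w J).1 ∨ p = genSnd (w J).1)) := by
  unfold vertPresent
  rw [Fin.ext_iff, Fin.ext_iff, genFst_val, genSnd_val]

/-- The number of present vertical segments across a crossing: `n`, or `n - 2` if it is
capcup-smoothed. [cite: AharonovJonesLandau2009, Def. 2.9] -/
theorem card_vertPresent (J : Fin m) :
    (Finset.univ.filter fun p : Fin n => (p : ℕ) < n ∧ vertPresent w s J p).card +
      (if s J = true then 2 else 0) = n := by
  classical
  have h1 : (Finset.univ.filter fun p : Fin n => (p : ℕ) < n ∧ vertPresent w s J p) =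
      Finset.univ.filter fun p : Fin n => vertPresent w s J p := by
    ext p; simp
  have h2 : (Finset.univ.filter fun p : Fin n => ¬ vertPresent w s J p).card = if s J = true then 2 else 0 := by
    by_cases hs : s J = true
    · rw [if_pos hs]
      have : (Finset.univ.filter fun p : Fin n => ¬ vertPresent w s J p) = {genFst (w J).1, genSnd (w J).1} := by
        ext p
        simp only [Finset.mem_filter, Finset.mem_univ, true_and, vertPresent_iff, not_not, hs, Finset.mem_insert,
          Finset.mem_singleton]
      rw [this, Finset.card_pair (genFst_ne_genSnd _)]
    · rw [if_neg hs]
      have : (Finset.univ.filter fun p : Fin n => ¬ vertPresent w s J p) = ∅ := by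
        ext p
        simp [vertPresent_iff, hs]
      rw [this, Finset.card_empty]
  rw [h1, ← h2, Finset.card_filter_add_card_filter_not]
  simp

/-- **The cap-state step, as a statement about matchings.** Joining the partners-or-equal
relation of `M` through a new cap `{i, i+1}` gives, on the points off the cap, the
partners-or-equal relation of the new matching (`M` itself if `i`, `i+1` were partners — a loop
closes — and the spliced matching otherwise). [cite: AharonovJonesLandau2009, Def. 2.5] -/
theorem NCMatching.cap_join_iff (M : NCMatching n) (i : Fin (n - 1)) {p p' : Fin n}
    (hp : ¬ p = genFst i ∧ ¬ p = genSnd i) (hp' : ¬ p' = genFst i ∧ ¬ p' = genSnd i) :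
    ((p' = p ∨ p' = M.mate p) ∨
      (((genFst i = p ∨ genFst i = M.mate p) ∧ (p' = genSnd i ∨ p' = M.mate (genSnd i))) ∨
       ((genSnd i = p ∨ genSnd i = M.mate p) ∧ (p' = genFst i ∨ p' = M.mate (genFst i))))) ↔
    p' = p ∨ p' = (if M.mate (genFst i) = genSnd i then M.mate p else M.spliceMate i p) := by
  have mm := M.mate_mate
  split_ifs with hm
  · -- `i`, `i+1` were partners: nothing new
    have hm' : M.mate (genSnd i) = genFst i := by rw [← hm, mm]
    constructor
    · rintro (h | ⟨h1, h2⟩ | ⟨h1, h2⟩)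
      · exact h
      · rcases h1 with h1 | h1
        · exact absurd h1.symm hp.1
        · exact absurd (by rw [← mm p, ← h1, hm]) hp.2
      · rcases h1 with h1 | h1
        · exact absurd h1.symm hp.2
        · exact absurd (by rw [← mm p, ← h1, hm']) hp.1
    · exact fun h => Or.inl h
  · -- splice
    constructor
    · rintro (h | ⟨h1, h2⟩ | ⟨h1, h2⟩)
      · rcases h with h | h
        · exact Or.inl h
        · right
          by_cases e3 : p = M.mate (genFst i)
          · exact absurd (by rw [h, e3, mm]) hp'.1
          by_cases e4 : p = M.mate (genSnd i)
          · exact absurd (by rw [h, e4, mm]) hp'.2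
          rw [NCMatching.spliceMate_of_ne hp.1 hp.2 e3 e4]; exact h
      · rcases h1 with h1 | h1
        · exact absurd h1.symm hp.1
        rcases h2 with h2 | h2
        · exact absurd h2 hp'.2
        right
        have e3 : p = M.mate (genFst i) := by rw [h1, mm]
        rw [e3, NCMatching.spliceMate_mate_fst hm]; exact h2
      · rcases h1 with h1 | h1
        · exact absurd h1.symm hp.2
        rcases h2 with h2 | h2
        · exact absurd h2 hp'.1
        right
        have e4 : p = M.mate (genSnd i) := by rw [h1, mm]
        rw [e4, NCMatching.spliceMate_mate_snd hm]; exact h2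
    · rintro (h | h)
      · exact Or.inl (Or.inl h)
      · by_cases e3 : p = M.mate (genFst i)
        · rw [e3, NCMatching.spliceMate_mate_fst hm] at h
          exact Or.inr (Or.inl ⟨Or.inr (by rw [e3, mm]), Or.inr h⟩)
        by_cases e4 : p = M.mate (genSnd i)
        · rw [e4, NCMatching.spliceMate_mate_snd hm] at h
          exact Or.inr (Or.inr ⟨Or.inr (by rw [e4, mm]), Or.inr h⟩)
        rw [NCMatching.spliceMate_of_ne hp.1 hp.2 e3 e4] at h
        exact Or.inl (Or.inr h)

/-- **One slice of the smoothed diagram** (cap, cup and vertical segments on top of an open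
diagram whose top-level reachability is the matching `M` with `c` loops closed): the component
count changes, and the new top level is matched, exactly as the cap-state calculus prescribes
(`sliceStep`); the points above stay isolated. [cite: AharonovJonesLandau2009, Def. 2.5 ("`m` extra closed loops") and Def. 2.9] -/
theorem slice_step (hI : SliceInv J Ω M) (c : ℕ) :
    (Nat.card (((Ω ⊔ capEdge w s J) ⊔ cupEdge w s J) ⊔ vertsGraph w s J n le_rfl).ConnectedComponent + n + c =
      Nat.card Ω.ConnectedComponent + (sliceStep (M, c) (w J).1 (s J)).2) ∧
    (∀ p p' : Fin n, (((Ω ⊔ capEdge w s J) ⊔ cupEdge w s J) ⊔ vertsGraph w s J n le_rfl).Reachable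
        (J.succ, p) (J.succ, p') ↔ p' = p ∨ p' = (sliceStep (M, c) (w J).1 (s J)).1.mate p) ∧
    (∀ x y : DiagramPoint m n, J.succ < x.1 →
      (((Ω ⊔ capEdge w s J) ⊔ cupEdge w s J) ⊔ vertsGraph w s J n le_rfl).Reachable x y → y = x) := by
  classical
  -- names
  have hlt : J.castSucc < J.succ := Fin.castSucc_lt_succ
  have hne01 : genFst (w J).1 ≠ genSnd (w J).1 := genFst_ne_genSnd _
  have Rup : ∀ z : DiagramPoint m n, J.castSucc < z.1 → ∀ y, Ω.Reachable z y ↔ y = z := fun z hz y =>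
    ⟨hI.above z y hz, fun h => h ▸ Reachable.refl _⟩
  have Rup' : ∀ z : DiagramPoint m n, J.castSucc < z.1 → ∀ y, Ω.Reachable y z ↔ y = z := fun z hz y => by
    rw [reachable_comm]; exact Rup z hz y
  obtain ⟨cAB, rAB⟩ := slice_capcup (w := w) (s := s) hI
  set GB := (Ω ⊔ capEdge w s J) ⊔ cupEdge w s J with hGB
  -- the points of level `J+1` carrying a vertical segment are isolated in `GB`
  have hiso : ∀ p : Fin n, vertPresent w s J p → ∀ y, GB.Reachable (J.succ, p) y → y = (J.succ, p) := by
    intro p hp y h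
    rw [rAB] at h
    rw [vertPresent_iff] at hp
    rcases h with (h | ⟨hs, ⟨h, -⟩ | ⟨h, -⟩⟩) | ⟨hs, ⟨h, -⟩ | ⟨h, -⟩⟩
    · exact (Rup _ hlt _).1 h
    · have := (Rup _ hlt _).1 h; exact absurd (congrArg Prod.fst this) hlt.ne
    · have := (Rup _ hlt _).1 h; exact absurd (congrArg Prod.fst this) hlt.ne
    · exact absurd ⟨hs, Or.inl (by simpa [Prod.ext_iff] using h)⟩ hp
    · exact absurd ⟨hs, Or.inr (by simpa [Prod.ext_iff] using h)⟩ hp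
  obtain ⟨cC, rC⟩ := slice_verts (w := w) (s := s) J GB hiso n le_rfl
  have hcount := card_vertPresent (w := w) (s := s) J
  refine ⟨?_, fun p p' => ?_, fun x y hx h => ?_⟩
  · -- the count
    simp only [sliceStep]
    by_cases hs : s J = true
    · rw [if_pos hs] at cAB hcount; simp only [hs, if_true]
      split_ifs at cAB ⊢ with hm <;> simp only [] <;> omega
    · rw [if_neg hs] at cAB hcount; simp only [hs]; simp only [Bool.false_eq_true, if_false]; omega
  · -- top-level reachability
    have hanc : ∀ q : Fin n, anchor w s J n (J.succ, q) =
        if vertPresent w s J q then (J.castSucc, q) else (J.succ, q) := by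
      intro q; unfold anchor; simp [q.2]
    rw [rC, hanc, hanc]
    by_cases hs : s J = true
    swap
    · -- identity smoothing: everything hangs straight down
      have hv : ∀ q : Fin n, vertPresent w s J q := fun q => by rw [vertPresent_iff]; simp [hs]
      rw [if_pos (hv p), if_pos (hv p'), rAB, hI.top]
      simp [sliceStep, hs]
    -- capcup smoothing; the three shapes of `GB`-reachability between level points
    have hv : ∀ q : Fin n, vertPresent w s J q ↔ ¬ (q = genFst (w J).1 ∨ q = genSnd (w J).1) := fun q => by
      rw [vertPresent_iff]; simp [hs]
    have Rcc : ∀ a b : Fin n, GB.Reachable (J.castSucc, a) (J.castSucc, b) ↔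
        (b = a ∨ b = M.mate a) ∨
          (((genFst (w J).1 = a ∨ genFst (w J).1 = M.mate a) ∧ (b = genSnd (w J).1 ∨ b = M.mate (genSnd (w J).1))) ∨
           ((genSnd (w J).1 = a ∨ genSnd (w J).1 = M.mate a) ∧ (b = genFst (w J).1 ∨ b = M.mate (genFst (w J).1)))) := by
      intro a b
      rw [rAB, hI.top, hI.top, hI.top, hI.top, hI.top]
      have n1 : ¬ ((J.castSucc, a) = ((J.succ, genFst (w J).1) : DiagramPoint m n)) := fun e =>
        absurd (congrArg Prod.fst e) hlt.ne
      have n2 : ¬ ((J.castSucc, a) = ((J.succ, genSnd (w J).1) : DiagramPoint m n)) := fun e =>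
        absurd (congrArg Prod.fst e) hlt.ne
      simp only [hs, true_and, n1, n2, false_and, or_false]
    have Rcs : ∀ a b : Fin n, ¬ GB.Reachable (J.castSucc, a) (J.succ, b) := by
      intro a b h
      rw [rAB] at h
      rcases h with (h | ⟨-, ⟨-, h⟩ | ⟨-, h⟩⟩) | ⟨-, ⟨h, -⟩ | ⟨h, -⟩⟩
      · exact absurd (congrArg Prod.fst ((Rup' _ hlt _).1 h)) hlt.ne
      · exact absurd (congrArg Prod.fst ((Rup' _ hlt _).1 h)) hlt.ne
      · exact absurd (congrArg Prod.fst ((Rup' _ hlt _).1 h)) hlt.ne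
      · exact absurd (congrArg Prod.fst h) hlt.ne
      · exact absurd (congrArg Prod.fst h) hlt.ne
    have Rss : ∀ a b : Fin n, GB.Reachable (J.succ, a) (J.succ, b) ↔
        b = a ∨ (a = genFst (w J).1 ∧ b = genSnd (w J).1) ∨ (a = genSnd (w J).1 ∧ b = genFst (w J).1) := by
      intro a b
      rw [rAB, Rup _ hlt]
      have n1 : ¬ Ω.Reachable (J.succ, a) (J.castSucc, genFst (w J).1) := fun h =>
        absurd (congrArg Prod.fst ((Rup _ hlt _).1 h)) hlt.ne
      have n2 : ¬ Ω.Reachable (J.succ, a) (J.castSucc, genSnd (w J).1) := fun h =>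
        absurd (congrArg Prod.fst ((Rup _ hlt _).1 h)) hlt.ne
      simp only [hs, true_and, n1, n2, false_and, or_false, Prod.mk.injEq, eq_comm (a := (J.succ, b))]
      simp [eq_comm]
    -- the new matching
    have hM' : ∀ q, (sliceStep (M, c) (w J).1 (s J)).1.mate q =
        if h : M.mate (genFst (w J).1) = genSnd (w J).1 then M.mate q else M.spliceMate (w J).1 q := by
      intro q; simp only [sliceStep, hs, if_true]; split_ifs <;> rfl
    rw [hM']
    simp only [dite_eq_ite]
    have mm := M.mate_mate
    by_cases hp : p = genFst (w J).1 ∨ p = genSnd (w J).1 <;>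
      by_cases hp' : p' = genFst (w J).1 ∨ p' = genSnd (w J).1
    · -- both on the cup
      rw [if_neg ((hv p).not.2 (not_not.2 hp)), if_neg ((hv p').not.2 (not_not.2 hp')), Rss]
      split_ifs with hm
      · have hm' : M.mate (genSnd (w J).1) = genFst (w J).1 := by rw [← hm, mm]
        rcases hp with rfl | rfl <;> rcases hp' with rfl | rfl <;> simp [hm, hm', hne01, hne01.symm]
      · rcases hp with rfl | rfl <;> rcases hp' with rfl | rfl <;>
          simp [NCMatching.spliceMate_fst, NCMatching.spliceMate_snd, hne01, hne01.symm]
    · -- `p` on the cup, `p'` hanging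
      rw [if_neg ((hv p).not.2 (not_not.2 hp)), if_pos ((hv p').2 hp'), reachable_comm]
      simp only [Rcs, false_iff, not_or]
      simp only [not_or] at hp'
      refine ⟨fun e => ?_, fun e => ?_⟩
      · rcases hp with rfl | rfl
        · exact hp'.1 e
        · exact hp'.2 e
      · split_ifs at e with hm
        · rcases hp with rfl | rfl
          · exact hp'.2 (by rw [e, hm])
          · exact hp'.1 (by rw [e, ← hm, mm])
        · rcases hp with rfl | rfl
          · exact hp'.2 (by rw [e, NCMatching.spliceMate_fst])
          · exact hp'.1 (by rw [e, NCMatching.spliceMate_snd])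
    · -- `p` hanging, `p'` on the cup
      rw [if_pos ((hv p).2 hp), if_neg ((hv p').not.2 (not_not.2 hp'))]
      simp only [Rcs, false_iff, not_or]
      simp only [not_or] at hp
      refine ⟨fun e => ?_, fun e => ?_⟩
      · rcases hp' with rfl | rfl
        · exact hp.1 e.symm
        · exact hp.2 e.symm
      · split_ifs at e with hm
        · rcases hp' with rfl | rfl
          · exact hp.2 (by rw [← mm p, ← e, hm])
          · exact hp.1 (by rw [← mm p, ← e, ← hm, mm])
        · rcases hp' with rfl | rfl
          · exact hp.2 (by rw [← NCMatching.spliceMate_spliceMate ?_ p, ← e, NCMatching.spliceMate_fst]; exact hm)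
          · exact hp.1 (by rw [← NCMatching.spliceMate_spliceMate ?_ p, ← e, NCMatching.spliceMate_snd]; exact hm)
    · -- both hanging: the cap-state step
      rw [if_pos ((hv p).2 hp), if_pos ((hv p').2 hp'), Rcc]
      simp only [not_or] at hp hp'
      exact M.cap_join_iff (w J).1 hp hp'
  · -- above level `J+1`
    have hx' : J.castSucc < x.1 := hlt.trans hx
    have hax : anchor w s J n x = x := anchor_of_ne J n x (ne_of_gt hx)
    rw [rC, hax, rAB] at h
    have hxU' : x ≠ (J.succ, genFst (w J).1) := fun e => absurd (congrArg Prod.fst e) (ne_of_gt hx)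
    have hxV' : x ≠ (J.succ, genSnd (w J).1) := fun e => absurd (congrArg Prod.fst e) (ne_of_gt hx)
    have key : anchor w s J n y = x := by
      rcases h with (h | ⟨-, ⟨h, -⟩ | ⟨h, -⟩⟩) | ⟨-, ⟨h, -⟩ | ⟨h, -⟩⟩
      · exact (Rup x hx' _).1 h
      · have := (Rup x hx' _).1 h; exact absurd (congrArg Prod.fst this).symm (ne_of_gt hx')
      · have := (Rup x hx' _).1 h; exact absurd (congrArg Prod.fst this).symm (ne_of_gt hx')
      · exact absurd h hxU'
      · exact absurd h hxV'
    rcases anchor_eq_or (w := w) (s := s) J n y with e | e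
    · rwa [e] at key
    · rw [key] at e
      exact absurd e (ne_of_gt hx')

end Slice

/-! ### Counting, III: all slices, the top caps, and `loopCount = cExt` -/

/-- The first `j` slices of the smoothed word, bottom-up. [cite: AharonovJonesLandau2009, Def. 2.5] -/
def prefixSlices (w : Fin m → Fin (n - 1) × Bool) (s : Fin m → Bool) (j : ℕ) (hj : j ≤ m) :
    List (Fin (n - 1) × Bool) :=
  List.ofFn fun j' : Fin j => ((w ⟨j', by omega⟩).1, s ⟨j', by omega⟩)

/-- One more slice. [folklore] -/
theorem prefixSlices_succ (j : ℕ) (hj : j + 1 ≤ m) :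
    prefixSlices w s (j + 1) hj = prefixSlices w s j (by omega) ++ [((w ⟨j, by omega⟩).1, s ⟨j, by omega⟩)] := by
  rw [prefixSlices, List.ofFn_succ', List.concat_eq_append]
  rfl

/-- All the slices. [folklore] -/
theorem prefixSlices_self : prefixSlices w s m le_rfl = List.ofFn fun j : Fin m => ((w j).1, s j) := by
  rw [prefixSlices]

/-- **The open diagram after `j` slices**: its component count and top-level matching are those
of the cap-state calculus run on the first `j` slices from the plat cups; the points above level
`j` are isolated. [cite: AharonovJonesLandau2009, Def. 2.5 and Def. 2.9] -/
theorem open_inv (hn : Even n) (j : ℕ) (hj : j ≤ m) :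
    (Nat.card (openGraph w s j hj).ConnectedComponent + j * n =
      (runSlices (prefixSlices w s j hj) (NCMatching.cups hn, 0)).2 + n / 2 + m * n) ∧
    (∀ p p' : Fin n, (openGraph w s j hj).Reachable (⟨j, by omega⟩, p) (⟨j, by omega⟩, p') ↔
      p' = p ∨ p' = (runSlices (prefixSlices w s j hj) (NCMatching.cups hn, 0)).1.mate p) ∧
    (∀ x y : DiagramPoint m n, (⟨j, by omega⟩ : Fin (m + 1)) < x.1 →
      (openGraph w s j hj).Reachable x y → y = x) := by
  induction j with
  | zero =>
    have hst : runSlices (prefixSlices w s 0 hj) (NCMatching.cups hn, 0) = (NCMatching.cups hn, 0) := by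
      simp [prefixSlices, runSlices]
    rw [hst]
    obtain ⟨hc, hr⟩ := capsGraph_inv (m := m) (n / 2) (Nat.mul_div_le n 2)
    refine ⟨?_, fun p p' => ?_, fun x y hx h => ?_⟩
    · rw [openGraph]
      show Nat.card (capsGraph (m := m) 0 (n / 2) (Nat.mul_div_le n 2)).ConnectedComponent + 0 * n =
        0 + n / 2 + m * n
      rw [Nat.succ_mul] at hc
      have ⟨r, hr'⟩ := hn
      omega
    · rw [openGraph, hr]
      have key : p' = (NCMatching.cups hn).mate p ↔
          ((p' : ℕ) = if Even (p : ℕ) then (p : ℕ) + 1 else (p : ℕ) - 1) := by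
        rw [Fin.ext_iff, NCMatching.cups_mate_val]
      show _ ↔ p' = p ∨ p' = (NCMatching.cups hn).mate p
      rw [key]
      have hmv := p.2
      have hmv' := p'.2
      obtain ⟨r, hr'⟩ := hn
      simp only [Prod.ext_iff, Fin.ext_iff, Fin.val_zero, true_and]
      split_ifs with he
      · rw [Nat.even_iff] at he; omega
      · rw [Nat.even_iff] at he; omega
    · rw [openGraph, hr] at h
      rcases h with h | ⟨h1, -⟩
      · exact h.symm
      · rw [h1] at hx
        exact absurd hx (Fin.not_lt_zero _)
  | succ j ih =>
    obtain ⟨hc, htop, habove⟩ := ih (by omega)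
    set J : Fin m := ⟨j, by omega⟩ with hJ
    set st := runSlices (prefixSlices w s j (by omega)) (NCMatching.cups hn, 0) with hst
    have hI : SliceInv J (openGraph w s j (by omega)) st.1 := ⟨htop, habove⟩
    obtain ⟨c1, c2, c3⟩ := slice_step (w := w) (s := s) hI st.2
    have hst' : runSlices (prefixSlices w s (j + 1) hj) (NCMatching.cups hn, 0) = sliceStep st (w J).1 (s J) := by
      rw [prefixSlices_succ, runSlices_append]; rfl
    have hG : openGraph w s (j + 1) hj =
        ((openGraph w s j (by omega) ⊔ capEdge w s J) ⊔ cupEdge w s J) ⊔ vertsGraph w s J n le_rfl := rfl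
    rw [hst', hG]
    have c1' : Nat.card (((openGraph w s j (by omega) ⊔ capEdge w s J) ⊔ cupEdge w s J) ⊔
        vertsGraph w s J n le_rfl).ConnectedComponent + n + st.2 =
        Nat.card (openGraph w s j (by omega)).ConnectedComponent + (sliceStep st (w J).1 (s J)).2 := c1
    refine ⟨?_, c2, c3⟩
    rw [Nat.succ_mul]
    omega

/-- **The top caps**: capping off the open diagram from the top index down reproduces the closing
slices of the cap-state calculus (`closingList`); at the end the component count is the loop
count it computes. [cite: AharonovJonesLandau2009, Def. 2.8 and Def. 2.9] -/
theorem close_inv (Ωm : SimpleGraph (DiagramPoint m n)) (t : ℕ) (ht : 2 * t ≤ n) (st : NCMatching n × ℕ)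
    (hcard : Nat.card (Ωm ⊔ topCapsFrom t).ConnectedComponent = st.2 + t)
    (hreach : ∀ p p' : Fin n, (p : ℕ) < 2 * t → (p' : ℕ) < 2 * t →
      ((Ωm ⊔ topCapsFrom t).Reachable (Fin.last m, p) (Fin.last m, p') ↔ p' = p ∨ p' = st.1.mate p)) :
    Nat.card (Ωm ⊔ topCapsFrom 0).ConnectedComponent = (runSlices (closingList n t ht) st).2 := by
  classical
  induction t generalizing st with
  | zero => simpa [closingList, runSlices] using hcard
  | succ t ih =>
    rw [closingList, runSlices_cons]
    -- the new cap
    set g : Fin (n - 1) := ⟨2 * t, by omega⟩ with hg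
    have hg0 : ((genFst g : Fin n) : ℕ) = 2 * t := rfl
    have hg1 : ((genSnd g : Fin n) : ℕ) = 2 * t + 1 := rfl
    set u : DiagramPoint m n := (Fin.last m, genFst g) with hu
    set v : DiagramPoint m n := (Fin.last m, genSnd g) with hv
    have hG : Ωm ⊔ topCapsFrom t = (Ωm ⊔ topCapsFrom (t + 1)) ⊔ edge u v := by
      rw [topCapsFrom_eq_sup t (by omega), sup_assoc]; rfl
    have huv : (Ωm ⊔ topCapsFrom (t + 1)).Reachable u v ↔ st.1.mate (genFst g) = genSnd g := by
      rw [hreach _ _ (by rw [hg0]; omega) (by rw [hg1]; omega)]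
      constructor
      · rintro (h | h)
        · exact absurd h (genFst_ne_genSnd g).symm
        · exact h.symm
      · exact fun h => Or.inr h.symm
    have hstep : ∀ q, (sliceStep st g true).1.mate q =
        if st.1.mate (genFst g) = genSnd g then st.1.mate q else st.1.spliceMate g q := by
      intro q; simp only [sliceStep, if_true]; split_ifs <;> rfl
    have hstep2 : (sliceStep st g true).2 = if st.1.mate (genFst g) = genSnd g then st.2 + 1 else st.2 := by
      simp only [sliceStep, if_true]; split_ifs <;> rfl
    apply ih
    · -- the count
      have key := card_connectedComponent_sup_edge (Ωm ⊔ topCapsFrom (t + 1)) u v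
      rw [← hG] at key
      rw [hstep2]
      by_cases hm : st.1.mate (genFst g) = genSnd g
      · rw [if_pos (huv.2 hm)] at key; rw [if_pos hm]; omega
      · rw [if_neg (fun h => hm (huv.1 h))] at key; rw [if_neg hm]; omega
    · -- reachability below `2t`
      intro p p' hp hp'
      have hpn : ¬ p = genFst g ∧ ¬ p = genSnd g :=
        ⟨fun e => by rw [e, hg0] at hp; omega, fun e => by rw [e, hg1] at hp; omega⟩
      have hpn' : ¬ p' = genFst g ∧ ¬ p' = genSnd g :=
        ⟨fun e => by rw [e, hg0] at hp'; omega, fun e => by rw [e, hg1] at hp'; omega⟩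
      rw [hG, reachable_sup_edge_iff, hstep, hreach _ _ (by omega) (by omega),
        hreach _ _ (by omega) (by rw [hg0]; omega), hreach _ _ (by rw [hg1]; omega) (by omega),
        hreach _ _ (by omega) (by rw [hg1]; omega), hreach _ _ (by rw [hg0]; omega) (by omega)]
      have e1 : (genFst g = p ∨ genFst g = st.1.mate p) ↔ (genFst g = p ∨ genFst g = st.1.mate p) := Iff.rfl
      rw [← st.1.cap_join_iff g hpn hpn']

/-- **The loop number of a smoothed plat diagram is computed by the cap-state calculus**:
`loopCount w s = cExt` (run the slices bottom-up from the plat cups — a capcup closes a loop on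
two partners and splices otherwise — then the closing capcups). [cite: AharonovJonesLandau2009, Def. 2.5 and Def. 2.9] -/
theorem loopCount_eq_cExt (hn : Even n) (w : Fin m → Fin (n - 1) × Bool) (s : Fin m → Bool) :
    loopCount w s = cExt hn (List.ofFn fun j : Fin m => ((w j).1, s j)) := by
  classical
  rw [loopCount_eq_card_platGraph, platGraph, cExt, ← prefixSlices_self (w := w) (s := s)]
  obtain ⟨hc, htop, -⟩ := open_inv (w := w) (s := s) hn m le_rfl
  set st := runSlices (prefixSlices w s m le_rfl) (NCMatching.cups hn, 0)
  have hbot : topCapsFrom (m := m) (n := n) (n / 2) = ⊥ := topCapsFrom_of_gt _ (by omega)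
  apply close_inv (openGraph w s m le_rfl) (n / 2) (Nat.mul_div_le n 2) st
  · rw [hbot, sup_bot_eq]; omega
  · intro p p' _ _
    rw [hbot, sup_bot_eq]
    exact htop p p'

/-! ### Discharge of `ajl_thm32_matrixElement` -/

/-- **AJL Thm. 3.2, the matrix-element identity, discharged:** for even `n ≥ 2`, `k ≥ 3` and every
braid word `w`, `⟨α| φ(w) |α⟩ = ⟨w^{pl}⟩(A_k) / d^{n/2-1}` — the algebraic half
(`ajl_thm32_of_loopCount`, `PathModelLinkStates.lean`: link states, L1–L3, Claim 3.8, the core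
identity) combined with the loop-count recursion of this file (`loopCount_eq_cExt`).
[cite: AharonovJonesLandau2009, Thm. 3.2 (proof) with Claim 3.8 and Lemma 2.2] -/
theorem ajl_thm32_matrixElement_holds : ajl_thm32_matrixElement :=
  ajl_thm32_of_loopCount fun _ _ hn w s => loopCount_eq_cExt hn w s

/-- Hence, unconditionally: the tree's normalised Jones modulus is the modulus of a diagonal entry
of the unitary `φ(b)`, `ajlRatio k n b = |⟨α|φ(b)|α⟩| ≤ 1` (the quantity estimated by the Hadamard
test of Algorithm Approximate-Jones-Plat-Closure). [cite: AharonovJonesLandau2009, Thm. 3.2 and §3.3] -/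
theorem ajlRatio_eq_norm {k n : ℕ} (hk : 3 ≤ k) (hn : Even n) (h2 : 2 ≤ n) (b : BraidWord n) :
    ajlRatio k n b = ‖ajlBraidMatrix k b (ajlAlpha n) (ajlAlpha n)‖ :=
  ajlRatio_eq_norm_of_thm32 ajl_thm32_matrixElement_holds hk hn h2 b

/-- `ajlRatio k n b ≤ 1` for even `n ≥ 2`, `k ≥ 3`. [cite: AharonovJonesLandau2009, Thm. 3.2 and §3.3] -/
theorem ajlRatio_le_one {k n : ℕ} (hk : 3 ≤ k) (hn : Even n) (h2 : 2 ≤ n) (b : BraidWord n) :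
    ajlRatio k n b ≤ 1 :=
  ajlRatio_le_one_of_thm32 ajl_thm32_matrixElement_holds hk hn h2 b

end PlatGraph

end Literature.Computability.QuantumComplexity

end
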